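import Literature.MathematicalPhysics.QuantumFieldTheory.Balaban1983to89.B9LettersZQstarFieldsAtPinsR
import Literature.MathematicalPhysics.QuantumFieldTheory.Balaban1983to89.B9BackgroundsKLevelV1R
import Literature.MathematicalPhysics.QuantumFieldTheory.Balaban1983to89.Node00.OpsYRecordV4P
import Literature.MathematicalPhysics.QuantumFieldTheory.Balaban1983to89.B9LettersZSchemasMono
import Literature.MathematicalPhysics.QuantumFieldTheory.Balaban1983to89.B9LettersHZAtOne

/-!
# BalabanUVNodes ∕ N06 ([B9], `Dag.B9_main`) — THE DISPLAYED `∇_{U,ν}G₀Q\*` AND `Φ^X_β∇_{U,ν}G₀Q\*` FAMILIES (`hdgQsd`, `hpQd` of the stage-11 certificate) DERIVED AT THE PINS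
# from the certificate's own G₀ layer (`Thm33G0Dir.e1d ∕ .h43d`, the directional letters of ∇_{U,ν}G₀ at rate δ12₀) and its pin of `Q\*` — member-uniformly, at rate δ12₃

Track A of `YM-PLAN.md` (cell `pub-ymgap`, HUMAN RULING D-0062), node **N06** = [Balaban1985BackgroundPropagators] Thms 3.1–3.15; bundle F7 rows 20–21, seat `pub-ymgap-dag-n06-l`
(g30); memo `DISPLAY-LEDGER-ROWS2021.md` §2 (the G₀Q\* family).  A HELPER for dag-n06-d's certificate editions after ED.77 «UD».
WHY.  ED.77 displays `hdgQsd : … ∀ ν, HasMaj Z_{n⁻¹} 𝔠⁽¹⁾ (∇_{U,ν}∘G₀∘Q\*) (B12₃e^{−δ12₃d})` and `hpQd : … ∀ ν β, HasMaj Z_{n⁻¹} 𝔠_P^{(β−1)} (Φ^X_β∘∇_{U,ν}∘G₀∘Q\*) (Bq12 β·e^{−δ12₃d})`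
(consumed by its `Letters313DMZ` record), although it DERIVES the G₀ layer `hG0C : Thm33G0Dir (𝔬12 x) (𝔭A x) Dd Dsd 1 (H x) (bHXA x) B12₀ Bh12 Bi12 Bi2₁₂ δ12₀ U ∧ …`
(`g0_layer_of_thm310_coreDir₃US`) and holds the pin `hQsco12`.  Both families are the G₀ letters composed with the LOCAL letter of `Q\*` (dag-n06-w5; carrier-generic twins
`B9LettersZQstarFieldsAtPinsR.dgQsd_pinsB ∕ pQd_pinsB`), so they follow at rate δ12₃ exactly (δ12₃ ≤ δ12₀; the `Q\*` letter holds at every rate, the [4] (2.61) row sum at any σ > 0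
only enters the constant).  THIS FILE packages that in the certificate's binder shapes: ★★★ `g0qstar_letters_of_pins` — ∃ `Md ≥ M12`, `Bd ≥ 0`, `Bq ≥ 0` (a function of β) such that
above `Md` both families hold with constants `Bd ∕ Bq β` at rate δ12₃ (inputs: the two FIELDS `e1d ∕ h43d` as member families at B12₀ ∕ Bh12 ∕ δ12₀, pins `hblk12 hblkZ12 hQsco12`,
`0 < σ12`, `0 ≤ δ12₃ ≤ δ12₀`).  The knit replaces the two displays by ONE `obtain` and raises its record's constants by `max`.
HONEST FRAMING.  By-name composition of kernel-checked helper files; the G₀-layer letters are HYPOTHESES; COUNT-NEUTRAL; nothing of [B9]'s propagator estimates asserted;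
N06 NOT discharged; K1 NOT closed; one finite 𝕋⁴ programme at fixed `ε` — NOT continuum, NOT OS, NOT the mass gap ∕ Clay.  0 `def`, 0 `sorry`.
-/

noncomputable section

namespace Summit.QuantumFields.YangMills.BalabanUVNodes.N06G0QstarLettersLegAtPinsPU

open scoped Matrix.Norms.L2Operator
open Literature.MathematicalPhysics.QuantumFieldTheory.Balaban1983to89
open Literature.MathematicalPhysics.QuantumFieldTheory.Balaban1983to89.Node00
open Literature.MathematicalPhysics.QuantumFieldTheory.Balaban1983to89.B9PinMembersKLevelV1 (MemberY geo9Y bg9Y)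
open Literature.MathematicalPhysics.QuantumFieldTheory.Balaban1983to89.B9BackgroundsKLevelV1R (RegFamY bg9YR MemOfFam mem_of_reg335R)
open Literature.MathematicalPhysics.QuantumFieldTheory.Balaban1983to89.B7Prop2SpecialUnitary (specialUnitaryUnits)
open Literature.MathematicalPhysics.QuantumFieldTheory.Balaban1983to89.B6GlobalChartV1 (blkV1)
open Literature.MathematicalPhysics.QuantumFieldTheory.Balaban1983to89.B6Ineq2142KLevelV1 (β lvl)
open Literature.MathematicalPhysics.QuantumFieldTheory.Balaban1983to89.B6Geom246MultiLevelTorus (geomT)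
open Literature.MathematicalPhysics.QuantumFieldTheory.Balaban1983to89.B6RandomWalkHom (HasMajorantHom)
open Literature.MathematicalPhysics.QuantumFieldTheory.Balaban1983to89.B9CoReadingCoordsTranspose (TrIdx trBasis)
open Literature.MathematicalPhysics.QuantumFieldTheory.Balaban1983to89.B9CoReadingCoords (XBK blkBK)
open Literature.MathematicalPhysics.QuantumFieldTheory.Balaban1983to89.B9CoReadingCoordsH (XHK blkHK)
open Literature.MathematicalPhysics.QuantumFieldTheory.Balaban1983to89.B9GeoNormsKLevelV1 (geo9K geo9K_dist_nonneg)
open Literature.MathematicalPhysics.QuantumFieldTheory.Balaban1983to89.B9GeoLemma21KLevelV1 (geo9Y_dist_triangle geo9Y_dist_comm geo9Y_len_pos rowSum261_geo9Y)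
open Literature.MathematicalPhysics.QuantumFieldTheory.Balaban1983to89.B9Thm34Ext (toB6)
open Literature.MathematicalPhysics.QuantumFieldTheory.Balaban1983to89.B9SectDSup (weightNorm)
open Literature.MathematicalPhysics.QuantumFieldTheory.Balaban1983to89.B11SectG (HasMaj BlockNorm RowSum)
open Literature.MathematicalPhysics.QuantumFieldTheory.Balaban1983to89.B9Thm312Whole (Ops GeoOK cNorm)
open Literature.MathematicalPhysics.QuantumFieldTheory.Balaban1983to89.B9Thm312WholeClasses (cNormR)
open Literature.MathematicalPhysics.QuantumFieldTheory.Balaban1983to89.B9RWSums343Holder (HolderProbes)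
open Literature.MathematicalPhysics.QuantumFieldTheory.Balaban1983to89.B9LettersHZAtOne (plateau_pos)
open Literature.MathematicalPhysics.QuantumFieldTheory.Balaban1983to89.Node00.OpsYSectDCoords (QscoKH)
open Literature.MathematicalPhysics.QuantumFieldTheory.Balaban1983to89.B9LettersZQstarFieldsAtPinsR (dgQsd_pinsB pQd_pinsB)

variable {N : ℕ}

/-- ★★★ **`∇_{U,ν}G₀Q\*` AND `Φ^X_β∇_{U,ν}G₀Q\*` AT THE PINS, MemberY θ.d₆ θ.ℓ₆ θ.hd' θ.hL' θ.b₀ θ.b₁ MstarBER-UNIFORMLY, FROM THE G₀ LAYER** (module docstring): from the directional letters `e1d ∕ h43d` of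
∇_{U,ν}G₀ at (B12₀ ∕ Bh12, δ12₀), the block maps and the pin of Q\*, ONE `obtain` gives `Md ≥ M12`, `Bd ≥ 0`, `Bq ≥ 0` and the certificate's families `hdgQsd ∕ hpQd` at rate δ12₃
with constants `Bd ∕ Bq β`.
[cite: Balaban1985BackgroundPropagators, Thm 3.12 pp.421–423, Thm 3.13 p.426, (3.126) p.420, (3.42)–(3.43) pp.397–398, (3.13) p.393; Balaban1984PropagatorsII, (2.52)–(2.56) pp.232–233, Lemma 2.1 (2.61) p.234] -/
theorem g0qstar_letters_of_pins (θ : Stage3Params) (Mstar : ℕ) {R₁ R₂ : RegFamY θ.d₆ θ.ℓ₆ θ.hd' θ.hL' θ.b₀ θ.b₁ Mstar (Matrix (Fin N) (Fin N) ℂ)} {c : ℝ}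
    (hGR : MemOfFam (specialUnitaryUnits (Fin N)) R₁)
    [∀ x : MemberY θ.d₆ θ.ℓ₆ θ.hd' θ.hL' θ.b₀ θ.b₁ Mstar, Fintype (geo9Y x).Site]
    (bI : ∀ x : MemberY θ.d₆ θ.ℓ₆ θ.hd' θ.hL' θ.b₀ θ.b₁ Mstar, FBondY x.toKIdx → IBondY x.toKIdx)
    (hβ1 : ∀ (x : MemberY θ.d₆ θ.ℓ₆ θ.hd' θ.hL' θ.b₀ θ.b₁ Mstar) (f : FBondY x.toKIdx), (geomT x.D).dist (β x.hN x.D x.hk (bI x f)) (blkV1 x.hN x.D f) ≤ 1)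
    (H12 : MemberY θ.d₆ θ.ℓ₆ θ.hd' θ.hL' θ.b₀ θ.b₁ Mstar → Prop) {W12 PX PY : MemberY θ.d₆ θ.ℓ₆ θ.hd' θ.hL' θ.b₀ θ.b₁ Mstar → Type} [∀ x, Fintype (W12 x)] [∀ x, Fintype (PX x)] [∀ x, Fintype (PY x)]
    (𝔬12 : ∀ x : MemberY θ.d₆ θ.ℓ₆ θ.hd' θ.hL' θ.b₀ θ.b₁ Mstar, B9Thm312Whole.Ops (geo9Y x) (bg9YR (Matrix (Fin N) (Fin N) ℂ) (specialUnitaryUnits (Fin N)) R₁ R₂ x) (XBK (TrIdx N) x.toKIdx) (XBK (TrIdx N) x.toKIdx) (XHK (TrIdx N) x.toKIdx) (W12 x))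
    (𝔭A : ∀ x : MemberY θ.d₆ θ.ℓ₆ θ.hd' θ.hL' θ.b₀ θ.b₁ Mstar, HolderProbes (geo9Y x) (bg9YR (Matrix (Fin N) (Fin N) ℂ) (specialUnitaryUnits (Fin N)) R₁ R₂ x) (XBK (TrIdx N) x.toKIdx) (XBK (TrIdx N) x.toKIdx) (PX x) (PY x))
    (Dd : ∀ x : MemberY θ.d₆ θ.ℓ₆ θ.hd' θ.hL' θ.b₀ θ.b₁ Mstar, (bg9YR (Matrix (Fin N) (Fin N) ℂ) (specialUnitaryUnits (Fin N)) R₁ R₂ x).Cfg → Fin (θ.d₆ + 1) → Module.End ℝ (XBK (TrIdx N) x.toKIdx → ℝ))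
    (hblk12 : ∀ x : MemberY θ.d₆ θ.ℓ₆ θ.hd' θ.hL' θ.b₀ θ.b₁ Mstar, (𝔬12 x).blk = blkBK x.toKIdx (bI x)) (hblkZ12 : ∀ x : MemberY θ.d₆ θ.ℓ₆ θ.hd' θ.hL' θ.b₀ θ.b₁ Mstar, (𝔬12 x).blkZ = blkHK x.toKIdx)
    (hQsco12 : ∀ (x : MemberY θ.d₆ θ.ℓ₆ θ.hd' θ.hL' θ.b₀ θ.b₁ Mstar) (U : (bg9YR (Matrix (Fin N) (Fin N) ℂ) (specialUnitaryUnits (Fin N)) R₁ R₂ x).Cfg), (𝔬12 x).Qstar U = QscoKH x.toKIdx (trBasis N) (bg9YR (Matrix (Fin N) (Fin N) ℂ) (specialUnitaryUnits (Fin N)) R₁ R₂ x) (fun U => U) (parBY x.toKIdx) U)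
    {M12 a12 B12₀ δ12₀ δ12₃ σ12 : ℝ} {Bh12 : ℝ → ℝ} (hB12₀ : 0 ≤ B12₀) (hBh12 : ∀ β, 0 ≤ β → β < 1 → 0 ≤ Bh12 β) (hσ12 : 0 < σ12)
    (hδ30 : 0 ≤ δ12₃) (hδ₃₀ : δ12₃ ≤ δ12₀)
    (he1d : ∀ x : MemberY θ.d₆ θ.ℓ₆ θ.hd' θ.hL' θ.b₀ θ.b₁ Mstar, M12 ≤ (geo9Y x).M → ∀ α₀ : ℝ, 0 < α₀ → (geo9Y x).M * α₀ ≤ a12 → ∀ U : (bg9YR (Matrix (Fin N) (Fin N) ℂ) (specialUnitaryUnits (Fin N)) R₁ R₂ x).Cfg, (bg9YR (Matrix (Fin N) (Fin N) ℂ) (specialUnitaryUnits (Fin N)) R₁ R₂ x).Reg335 c α₀ U →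
      (bg9YR (Matrix (Fin N) (Fin N) ℂ) (specialUnitaryUnits (Fin N)) R₁ R₂ x).Reg336 c α₀ U → ∀ ν : Fin (θ.d₆ + 1), HasMajorantHom (g := toB6 (geo9Y x) 1 (H12 x)) (𝔬12 x).blk (𝔬12 x).blk (Dd x U ν ∘ₗ (𝔬12 x).G0 U)
      (fun (a b : (geo9Y x).Site) => B12₀ * (geo9Y x).len a * Real.exp (-(δ12₀ * (geo9Y x).dist a b))))
    (h43d : ∀ x : MemberY θ.d₆ θ.ℓ₆ θ.hd' θ.hL' θ.b₀ θ.b₁ Mstar, M12 ≤ (geo9Y x).M → ∀ α₀ : ℝ, 0 < α₀ → (geo9Y x).M * α₀ ≤ a12 → ∀ U : (bg9YR (Matrix (Fin N) (Fin N) ℂ) (specialUnitaryUnits (Fin N)) R₁ R₂ x).Cfg, (bg9YR (Matrix (Fin N) (Fin N) ℂ) (specialUnitaryUnits (Fin N)) R₁ R₂ x).Reg335 c α₀ U →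
      (bg9YR (Matrix (Fin N) (Fin N) ℂ) (specialUnitaryUnits (Fin N)) R₁ R₂ x).Reg336 c α₀ U → ∀ (ν : Fin (θ.d₆ + 1)) (β : ℝ), 0 ≤ β → β < 1 →
      HasMajorantHom (g := toB6 (geo9Y x) 1 (H12 x)) (𝔬12 x).blk (𝔭A x).blkPX ((𝔭A x).ΦX U β ∘ₗ (Dd x U ν ∘ₗ (𝔬12 x).G0 U))
        (fun (a b : (geo9Y x).Site) => Bh12 β * (geo9Y x).len a ^ (1 - β) * Real.exp (-(δ12₀ * (geo9Y x).dist a b)))) :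
    ∃ (Md Bd : ℝ) (Bq : ℝ → ℝ), M12 ≤ Md ∧ 0 ≤ Bd ∧ (∀ β, 0 ≤ Bq β) ∧
      ∀ x : MemberY θ.d₆ θ.ℓ₆ θ.hd' θ.hL' θ.b₀ θ.b₁ Mstar, Md ≤ (geo9Y x).M → ∀ α₀ : ℝ, 0 < α₀ → (geo9Y x).M * α₀ ≤ a12 → ∀ U : (bg9YR (Matrix (Fin N) (Fin N) ℂ) (specialUnitaryUnits (Fin N)) R₁ R₂ x).Cfg, (bg9YR (Matrix (Fin N) (Fin N) ℂ) (specialUnitaryUnits (Fin N)) R₁ R₂ x).Reg335 c α₀ U → (bg9YR (Matrix (Fin N) (Fin N) ℂ) (specialUnitaryUnits (Fin N)) R₁ R₂ x).Reg336 c α₀ U →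
        (∀ ν : Fin (θ.d₆ + 1), HasMaj (weightNorm (BlockNorm.ofBlocks (toB6 (geo9Y x) 1 (H12 x)) (𝔬12 x).blkZ) (fun y => ((((θ.ℓ₆ + 1 : ℕ) : ℝ) ^ (θ.d₆ + 1)) ^ lvl x.hN x.D x.hk y)⁻¹) (fun y => (plateau_pos x.toKIdx y).le)) (cNorm 1 (H12 x) (𝔬12 x).blk (fun y => (geo9Y_len_pos x y).le) 1)
          (Dd x U ν ∘ₗ (𝔬12 x).G0 U ∘ₗ (𝔬12 x).Qstar U) (fun a b => Bd * Real.exp (-(δ12₃ * (geo9Y x).dist a b)))) ∧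
        (∀ (ν : Fin (θ.d₆ + 1)) (β : ℝ), 0 ≤ β → β < 1 →
          HasMaj (weightNorm (BlockNorm.ofBlocks (toB6 (geo9Y x) 1 (H12 x)) (𝔬12 x).blkZ) (fun y => ((((θ.ℓ₆ + 1 : ℕ) : ℝ) ^ (θ.d₆ + 1)) ^ lvl x.hN x.D x.hk y)⁻¹) (fun y => (plateau_pos x.toKIdx y).le)) (cNormR 1 (H12 x) (𝔭A x).blkPX (fun y => (geo9Y_len_pos x y).le) (β - 1))
            (((𝔭A x).ΦX U β ∘ₗ Dd x U ν ∘ₗ (𝔬12 x).G0 U) ∘ₗ (𝔬12 x).Qstar U) (fun a b => Bq β * Real.exp (-(δ12₃ * (geo9Y x).dist a b)))) := by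
  -- a [4] (2.61) row sum at rate σ12 (only its constant enters)
  obtain ⟨ML, cL, hrowL⟩ := rowSum261_geo9Y (d := θ.d₆) (ℓ := θ.ℓ₆) (hd := θ.hd') (hL := θ.hL') (b₀ := θ.b₀) (b₁ := θ.b₁) (Mstar := Mstar) σ12 hσ12
  have hrow : ∀ x : MemberY θ.d₆ θ.ℓ₆ θ.hd' θ.hL' θ.b₀ θ.b₁ Mstar, ML ≤ (geo9Y x).M → RowSum (toB6 (geo9Y x) 1 (H12 x)) σ12 (max cL 0) := fun x hM y => (hrowL x hM y).trans (le_max_left _ _)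
  set E : ℝ := Real.exp ((δ12₃ + σ12) * ((θ.ℓ₆ : ℝ) + 4)) * max cL 0 with hEd
  have hE0 : 0 ≤ E := mul_nonneg (Real.exp_nonneg _) (le_max_right _ _)
  refine ⟨max M12 ML, B12₀ * E, fun β => max (Bh12 β) 0 * E, le_max_left _ _, mul_nonneg hB12₀ hE0, fun β => mul_nonneg (le_max_right _ _) hE0,
    fun x hM α₀ hα ha U hU hU' => ?_⟩
  have hM12x : M12 ≤ (geo9Y x).M := (le_max_left _ _).trans hM
  have hMLx : ML ≤ (geo9Y x).M := (le_max_right _ _).trans hM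
  have hUG := mem_of_reg335R hGR x hU
  have hσQ : (0 : ℝ) ≤ δ12₃ + σ12 := by linarith
  have hBd : B12₀ * Real.exp ((δ12₃ + σ12) * ((θ.ℓ₆ : ℝ) + 4)) * max cL 0 ≤ B12₀ * E := by rw [hEd, mul_assoc]
  have hBq : ∀ β, 0 ≤ β → β < 1 → Bh12 β * Real.exp ((δ12₃ + σ12) * ((θ.ℓ₆ : ℝ) + 4)) * max cL 0 ≤ max (Bh12 β) 0 * E := fun β _ _ => by
    rw [hEd, ← mul_assoc]; exact mul_le_mul_of_nonneg_right (mul_le_mul_of_nonneg_right (le_max_left _ _) (Real.exp_nonneg _)) (le_max_right _ _)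
  refine ⟨dgQsd_pinsB x (hβ1 x) (B := (bg9YR (Matrix (Fin N) (Fin N) ℂ) (specialUnitaryUnits (Fin N)) R₁ R₂ x)) (cfg := fun U => U) (𝔬 := 𝔬12 x) (Dd := Dd x) (H := H12 x) (B₀ := B12₀) (δ₀ := δ12₀) (σ := σ12) (c := max cL 0)
      (δ₃ := δ12₃) (δQ := δ12₃ + σ12) (B₃ := B12₀ * E) (U := U) hUG (hrow x hMLx) (le_max_right _ _) hB12₀ hσQ hδ30 hδ₃₀ le_rfl hBd (hblk12 x) (hblkZ12 x) (hQsco12 x U)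
      (he1d x hM12x α₀ hα ha U hU hU') (fun y => (plateau_pos x.toKIdx y).le),
    pQd_pinsB x (hβ1 x) (B := (bg9YR (Matrix (Fin N) (Fin N) ℂ) (specialUnitaryUnits (Fin N)) R₁ R₂ x)) (cfg := fun U => U) (𝔬 := 𝔬12 x) (𝔭 := 𝔭A x) (Dd := Dd x) (H := H12 x) (Bh := Bh12) (Bq := fun β => max (Bh12 β) 0 * E) (δ₀ := δ12₀)
      (σ := σ12) (c := max cL 0) (δ₃ := δ12₃) (δQ := δ12₃ + σ12) (U := U) hUG (hrow x hMLx) (le_max_right _ _) hBh12 hσQ hδ30 hδ₃₀ le_rfl hBq (hblk12 x) (hblkZ12 x)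
      (hQsco12 x U) (h43d x hM12x α₀ hα ha U hU hU') (fun y => (plateau_pos x.toKIdx y).le)⟩

end Summit.QuantumFields.YangMills.BalabanUVNodes.N06G0QstarLettersLegAtPinsPU

end
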